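import Summits.QuantumAdvantage.QuantumAdvantage.Theorems.LinnikCubicClassGroupsDegreeOnePrimesEscapeDivisionTheta
import Summits.QuantumAdvantage.QuantumAdvantage.Theorems.LinnikCubicClassGroupsDegreeOnePrimesEscapeDivisionCount
import Literature.NumberTheory.LFunctions.HeilbronnStarkGaloisSubfields
import HarnessLib

/-!
# Exceptional-zero bookkeeping in the subfields of a Galois number field

Topic `Summits/QuantumAdvantage/QuantumAdvantage/Theorems`, cell B2b-1 (linnik-cubic), PART A (gen 9);
helper toward the crux `DegreeOnePrimesEscape` (stmt-QuantumAdvantage-11543) of route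
`LinnikCubicClassGroups`.  HONEST FRAMING: the value of this file is a THEOREM (kernel-checked, GRH-free,
no hypothesis) — NOT summit progress.

For a Galois number field `N` of degree `n > 1`, `d = |d_N|`, and a window constant `c ≤ c₀(n)` (the
Landau–Page constant of `exists_exceptionalZero_const`):

* `subfield_realZero_le_of_no_exceptional` — if `ζ_N` has NO real zero in `(1 − c/(log d + log 4), 1)`, then
  every real zero `β < 1` of `ζ_E`, `E ⊆ N` a subfield, satisfies `β ≤ 1 − c/(log d + log 4)` (Aramata–Brauer:
  the zeros of `ζ_E` are zeros of `ζ_N`, `dedekindZetaCont_eq_zero_of_intermediateField`);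
* `subfield_realZero_le_of_ne` — if `β₁` IS such a zero of `ζ_N` and `ζ_E(β₁) ≠ 0`, the same conclusion for
  the real zeros `β` of `ζ_E` (Landau–Page uniqueness for `ζ_N`);
* `exists_index_two_of_exceptional` — Heilbronn–Stark: for `c ≤ 1/4` such a `β₁` determines a subgroup
  `K₁ ≤ Gal(N/ℚ)` of index `2` with `ζ₁_{N^H}(β₁) = 0 ↔ H ≤ K₁`;
* `condQn_intermediateField_le`, `zpowers_pow_ne_top` — sizes: `Q_E ≤ d^{1+n²}` for every subfield of
  degree `> 1`, and `⟨σ^d⟩ ≠ G` for `1 < d ∣ ord σ`.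

References: H. M. Stark, Invent. Math. 23 (1974), Thm. 3 [Stark1974]; J. Thorner, A. Zaman, Algebra Number
Theory 13 (2019), Thm. 3.1 [ThornerZaman2019].
-/

noncomputable section

open scoped NumberField nonZeroDivisors
open Finset Real Ideal NumberField
open Literature.NumberTheory.NumberFields Literature.NumberTheory.LFunctions
  Literature.NumberTheory.LFunctions.NumberField

namespace Summit.QuantumAdvantage.QuantumAdvantage.Theorems.DegreeOnePrimesEscape

section Zeros

variable {N : Type} [Field N] [NumberField N] [IsGalois ℚ N]

/-- A real zero `β < 1` of `ζ₁_E` for a subfield `E ⊆ N` is a zero of `ζ₁_N` (Aramata–Brauer). -/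
theorem dedekindZeta₁_eq_zero_of_intermediateField (E : IntermediateField ℚ N) {β : ℝ} (hβ1 : β < 1)
    (h0 : dedekindZeta₁ E β = 0) : dedekindZeta₁ N β = 0 := by
  have hβne : (β : ℂ) ≠ 1 := fun h => hβ1.ne (by exact_mod_cast h)
  rw [dedekindZeta₁_eq_zero_iff hβne] at h0 ⊢
  exact dedekindZetaCont_eq_zero_of_intermediateField N E hβne h0

omit [IsGalois ℚ N] in
/-- The Landau–Page window hypothesis at a real point, in the form consumed by
`exists_exceptionalZero_const`. -/
theorem lpZ_of_window {c c₀ : ℝ} (hcc₀ : c ≤ c₀) {β : ℝ} (h0 : dedekindZeta₁ N β = 0)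
    (hβ : 1 - c / (Real.log ((NumberField.discr N).natAbs : ℝ) + Real.log 4) < β) :
    (((1 : ClassGroup (𝓞 N) →* ℂˣ) = 1 → dedekindZeta₁ N β = 0) ∧
      ((1 : ClassGroup (𝓞 N) →* ℂˣ) ≠ 1 → classGroupLFunction₀ N 1 β = 0)) ∧
      1 - c₀ / (Real.log ((NumberField.discr N).natAbs : ℝ) + Real.log (|((β : ℂ)).im| + 4)) < ((β : ℂ)).re := by
  refine ⟨⟨fun _ => h0, fun h => absurd rfl h⟩, ?_⟩
  rw [Complex.ofReal_im, abs_zero, zero_add, Complex.ofReal_re]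
  have hlogd : 0 ≤ Real.log ((NumberField.discr N).natAbs : ℝ) := Real.log_natCast_nonneg _
  have hlog4 : 0 < Real.log 4 := Real.log_pos (by norm_num)
  have := div_le_div_of_nonneg_right hcc₀ (by linarith : 0 ≤ Real.log ((NumberField.discr N).natAbs : ℝ) + Real.log 4)
  linarith

/-- **No exceptional zero for `N` ⟹ the real zeros of the subfields lie outside the window.**  If `ζ₁_N`
has no real zero in `(1 − c/(log|d_N| + log 4), 1)` then every real zero `β < 1` of `ζ₁_E`, `E ⊆ N`,
has `β ≤ 1 − c/(log|d_N| + log 4)`. -/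
theorem subfield_realZero_le_of_no_exceptional {c : ℝ}
    (hA : ¬ ∃ β₁ : ℝ, dedekindZeta₁ N β₁ = 0 ∧
      1 - c / (Real.log ((NumberField.discr N).natAbs : ℝ) + Real.log 4) < β₁ ∧ β₁ < 1)
    (E : IntermediateField ℚ N) {β : ℝ} (hβ1 : β < 1) (h0 : dedekindZeta₁ E β = 0) :
    β ≤ 1 - c / (Real.log ((NumberField.discr N).natAbs : ℝ) + Real.log 4) := by
  by_contra h
  push Not at h
  exact hA ⟨β, dedekindZeta₁_eq_zero_of_intermediateField E hβ1 h0, h, hβ1⟩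

/-- **With an exceptional zero `β₁` of `N`, the OTHER real zeros of the subfields lie outside the window**
(Landau–Page uniqueness for `ζ_N`, `c ≤ c₀(n)`): if `ζ₁_E(β₁) ≠ 0` then every real zero `β < 1` of `ζ₁_E`
has `β ≤ 1 − c/(log|d_N| + log 4)`. -/
theorem subfield_realZero_le_of_ne {n : ℕ} (hN : Module.finrank ℚ N = n) {c c₀ : ℝ} (hcc₀ : c ≤ c₀)
    (hLP : ∀ (K : Type) [Field K] [NumberField K], Module.finrank ℚ K = n →
      let Z : (ClassGroup (𝓞 K) →* ℂˣ) → ℂ → Prop := fun χ ρ ↦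
        ((χ = 1 → dedekindZeta₁ K ρ = 0) ∧ (χ ≠ 1 → classGroupLFunction₀ K χ ρ = 0)) ∧
          1 - c₀ / (Real.log ((discr K).natAbs : ℝ) + Real.log (|ρ.im| + 4)) < ρ.re
      (∀ χ ρ, Z χ ρ → ρ.im = 0 ∧ χ * χ = 1) ∧
      (∀ χ₁ χ₂ ρ₁ ρ₂, Z χ₁ ρ₁ → Z χ₂ ρ₂ → χ₁ = χ₂ ∧ ρ₁ = ρ₂) ∧
      (∀ χ ρ, Z χ ρ → (χ = 1 → analyticOrderAt (dedekindZeta₁ K) ρ = 1) ∧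
        (χ ≠ 1 → analyticOrderAt (classGroupLFunction₀ K χ) ρ = 1)))
    {β₁ : ℝ} (h0₁ : dedekindZeta₁ N β₁ = 0)
    (hβ₁ : 1 - c / (Real.log ((NumberField.discr N).natAbs : ℝ) + Real.log 4) < β₁)
    (E : IntermediateField ℚ N) (hE : dedekindZeta₁ E β₁ ≠ 0) {β : ℝ} (hβ1 : β < 1)
    (h0 : dedekindZeta₁ E β = 0) :
    β ≤ 1 - c / (Real.log ((NumberField.discr N).natAbs : ℝ) + Real.log 4) := by
  by_contra h
  push Not at h
  obtain ⟨-, hLPuniq, -⟩ := hLP N hN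
  have hZ := lpZ_of_window hcc₀ (dedekindZeta₁_eq_zero_of_intermediateField E hβ1 h0) h
  have hZ₁ := lpZ_of_window hcc₀ h0₁ hβ₁
  obtain ⟨-, heq⟩ := hLPuniq 1 1 (β : ℂ) (β₁ : ℂ) hZ hZ₁
  have hββ₁ : β = β₁ := by exact_mod_cast heq
  exact hE (hββ₁ ▸ h0)

/-- **Heilbronn–Stark for the exceptional zero** (`c ≤ 1/4` puts `β₁` in Stark's box of `N`): a subgroup
`K₁ ≤ Gal(N/ℚ)` of index `2` with `ζ₁_{N^H}(β₁) = 0 ↔ H ≤ K₁` for every `H`. [cite: Stark1974, Thm. 3] -/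
theorem exists_index_two_of_exceptional (hN : 1 < Module.finrank ℚ N) {c : ℝ} (hc4 : c ≤ 1 / 4)
    {β₁ : ℝ} (h0₁ : dedekindZeta₁ N β₁ = 0)
    (hβ₁ : 1 - c / (Real.log ((NumberField.discr N).natAbs : ℝ) + Real.log 4) < β₁) (hβ₁1 : β₁ < 1) :
    ∃ K₁ : Subgroup (N ≃ₐ[ℚ] N), K₁.index = 2 ∧
      ∀ H : Subgroup (N ≃ₐ[ℚ] N), dedekindZeta₁ (IntermediateField.fixedField H) β₁ = 0 ↔ H ≤ K₁ := by
  have hβne : (β₁ : ℂ) ≠ 1 := fun h => hβ₁1.ne (by exact_mod_cast h)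
  have hd3 : (3 : ℝ) ≤ ((NumberField.discr N).natAbs : ℝ) := three_le_natAbs_discr_real N hN
  have hlogd : 1 < Real.log ((NumberField.discr N).natAbs : ℝ) := by
    have h3 : 1 < Real.log 3 := by
      have h23 : Real.log 2 * (3 / 2) ≤ Real.log 3 := by
        have := Real.log_le_log (by norm_num : (0:ℝ) < 2 ^ (3:ℕ)) (by norm_num : (2:ℝ) ^ (3:ℕ) ≤ 3 ^ (2:ℕ))
        rw [Real.log_pow, Real.log_pow] at this
        push_cast at this
        linarith
      have := Real.log_two_gt_d9
      linarith
    exact lt_of_lt_of_le h3 (Real.log_le_log (by norm_num) hd3)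
  have hlog4 : 0 < Real.log 4 := Real.log_pos (by norm_num)
  have hbox : 1 - 1 / (4 * Real.log ((NumberField.discr N).natAbs : ℝ)) ≤ β₁ := by
    have h1 : c / (Real.log ((NumberField.discr N).natAbs : ℝ) + Real.log 4) ≤
        1 / (4 * Real.log ((NumberField.discr N).natAbs : ℝ)) := by
      rw [div_le_div_iff₀ (by linarith) (by positivity)]
      nlinarith
    linarith
  have h0' : dedekindZetaCont N β₁ = 0 := (dedekindZeta₁_eq_zero_iff hβne).mp h0₁
  obtain ⟨K₁, hK₁, hiff⟩ :=
    exists_index_two_forall_dedekindZetaCont_fixedField_eq_zero_iff N hN hbox hβ₁1 h0'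
  refine ⟨K₁, hK₁, fun H => ?_⟩
  rw [dedekindZeta₁_eq_zero_iff hβne]
  exact hiff H

end Zeros

/-! ### Sizes of the subfields -/

section Sizes

variable {N : Type} [Field N] [NumberField N] [IsGalois ℚ N]

omit [IsGalois ℚ N] in
/-- `m^m ≤ d^{n²}` for `1 ≤ m ≤ n` and `d ≥ 3`. -/
theorem pow_self_le_rpow_sq {m n : ℕ} (hm : m ≤ n) {d : ℝ} (hd : 3 ≤ d) :
    (m : ℝ) ^ m ≤ d ^ (n * n) := by
  have hn : (n : ℝ) ≤ d ^ n := by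
    have h1 : (n : ℝ) < 2 ^ n := by exact_mod_cast Nat.lt_two_pow_self
    have h2 : (2 : ℝ) ^ n ≤ d ^ n := pow_le_pow_left₀ (by norm_num) (by linarith) n
    linarith
  have hd1 : (1 : ℝ) ≤ d := by linarith
  calc (m : ℝ) ^ m ≤ (n : ℝ) ^ m := pow_le_pow_left₀ (Nat.cast_nonneg _) (by exact_mod_cast hm) m
    _ ≤ (d ^ n) ^ m := pow_le_pow_left₀ (Nat.cast_nonneg _) hn m
    _ = d ^ (n * m) := by rw [← pow_mul]
    _ ≤ d ^ (n * n) := pow_le_pow_right₀ hd1 (Nat.mul_le_mul_left n hm)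

omit [IsGalois ℚ N] in
/-- **Subfield sizes**: `Q_E = |d_E|·k^k ≤ |d_N|^{1+n²}` for a subfield `E ⊆ N` (`[N:ℚ] = n > 1`). -/
theorem condQn_intermediateField_le {n : ℕ} (hN : Module.finrank ℚ N = n) (hn : 1 < n)
    (E : IntermediateField ℚ N) :
    ThornerZaman.condQn E ≤ (((NumberField.discr N).natAbs : ℝ)) ^ ((1 : ℝ) + n * n) := by
  set d : ℝ := ((NumberField.discr N).natAbs : ℝ) with hd
  have hd3 : (3 : ℝ) ≤ d := three_le_natAbs_discr_real N (by rw [hN]; exact hn)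
  have hd0 : (0 : ℝ) < d := by linarith
  have hle : Module.finrank ℚ E ≤ n := by
    have h2 := Module.finrank_mul_finrank ℚ E N
    rw [hN] at h2
    have hpos : 0 < Module.finrank E N := Module.finrank_pos
    exact le_of_le_of_eq (Nat.le_mul_of_pos_right _ hpos) h2
  have hdE : ((NumberField.discr E).natAbs : ℝ) ≤ d := by
    have hdvd := NumberField.discr_dvd_discr E N
    rw [hd]
    exact_mod_cast Nat.le_of_dvd (Int.natAbs_pos.mpr (NumberField.discr_ne_zero N))
      (Int.natAbs_dvd_natAbs.mpr hdvd)
  rw [ThornerZaman.condQn, ← Int.cast_abs, Int.abs_eq_natAbs, Int.cast_natCast,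
    show (1 : ℝ) + n * n = (((1 + n * n : ℕ)) : ℝ) by push_cast; ring, Real.rpow_natCast,
    pow_add, pow_one]
  exact mul_le_mul hdE (pow_self_le_rpow_sq hle hd3) (by positivity) hd0.le

omit [IsGalois ℚ N] in
/-- `Q_E^a ≤ d^L` for a subfield `E ⊆ N` whenever `0 ≤ a ≤ A` and `(1 + n²)A ≤ L`. -/
theorem condQn_intermediateField_rpow_le {n : ℕ} (hN : Module.finrank ℚ N = n) (hn : 1 < n)
    (E : IntermediateField ℚ N) (hE : 1 < Module.finrank ℚ E) {a A L : ℝ} (ha : 0 ≤ a) (haA : a ≤ A)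
    (hL : ((1 : ℝ) + n * n) * A ≤ L) :
    ThornerZaman.condQn E ^ a ≤ (((NumberField.discr N).natAbs : ℝ)) ^ L := by
  set d : ℝ := ((NumberField.discr N).natAbs : ℝ) with hd
  have hd3 : (3 : ℝ) ≤ d := three_le_natAbs_discr_real N (by rw [hN]; exact hn)
  have hd1 : (1 : ℝ) ≤ d := by linarith
  have hQ12 : (12 : ℝ) ≤ ThornerZaman.condQn E := ThornerZaman.twelve_le_condQn (K := E) hE
  have hQ := condQn_intermediateField_le hN hn E
  have hdp : (1 : ℝ) ≤ d ^ ((1 : ℝ) + n * n) := Real.one_le_rpow hd1 (by positivity)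
  calc ThornerZaman.condQn E ^ a ≤ (d ^ ((1 : ℝ) + n * n)) ^ a :=
        Real.rpow_le_rpow (by linarith) hQ ha
    _ ≤ (d ^ ((1 : ℝ) + n * n)) ^ A := Real.rpow_le_rpow_of_exponent_le hdp haA
    _ = d ^ (((1 : ℝ) + n * n) * A) := by rw [← Real.rpow_mul (by linarith)]
    _ ≤ d ^ L := Real.rpow_le_rpow_of_exponent_le hd1 hL

/-- `⟨σ^d⟩ ≠ G` for `1 < d ∣ ord σ` (its order `ord σ / d` is smaller than `ord σ ≤ |G|`). -/
theorem zpowers_pow_ne_top {G : Type*} [Group G] [Finite G] (σ : G) {d : ℕ} (hd : d ∣ orderOf σ)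
    (h1 : 1 < d) : Subgroup.zpowers (σ ^ d) ≠ ⊤ := by
  intro htop
  have hd0 : d ≠ 0 := by omega
  have hcard : Nat.card (Subgroup.zpowers (σ ^ d)) = orderOf σ / d := by
    rw [Nat.card_zpowers, orderOf_pow_of_dvd hd0 hd]
  have hσ : σ ∈ Subgroup.zpowers (σ ^ d) := by rw [htop]; exact Subgroup.mem_top σ
  have hle : orderOf σ ∣ orderOf (σ ^ d) := orderOf_dvd_of_mem_zpowers hσ
  rw [orderOf_pow_of_dvd hd0 hd] at hle
  have hpos : 0 < orderOf σ := orderOf_pos σ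
  have h2 : orderOf σ ≤ orderOf σ / d := Nat.le_of_dvd (Nat.div_pos (Nat.le_of_dvd hpos hd) (by omega)) hle
  have h3 : orderOf σ / d < orderOf σ := Nat.div_lt_self hpos h1
  omega

omit [IsGalois ℚ N] in
/-- The number of divisors of `ord σ` is at most `[N:ℚ]`. -/
theorem card_divisors_orderOf_le [IsGalois ℚ N] (σ : N ≃ₐ[ℚ] N) :
    ((orderOf σ).divisors.card : ℝ) ≤ Module.finrank ℚ N := by
  have h1 : (orderOf σ).divisors.card ≤ orderOf σ := Nat.card_divisors_le_self _
  have h2 : orderOf σ ≤ Module.finrank ℚ N := by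
    rw [← IsGalois.card_aut_eq_finrank, Nat.card_eq_fintype_card]
    exact orderOf_le_card_univ
  exact_mod_cast h1.trans h2

/-- `1/(ord σ · |G|) ≥ 1/n²` with `n = [N:ℚ]`, so `Σ_{d ∣ ord σ} μ(d)/d ≥ 1/n²`. -/
theorem sum_moebius_div_ge_inv_sq {n : ℕ} (hN : Module.finrank ℚ N = n) (hn : 1 < n) (σ : N ≃ₐ[ℚ] N) :
    1 / ((n : ℝ) ^ 2) ≤ ∑ d ∈ (orderOf σ).divisors, (ArithmeticFunction.moebius d : ℝ) / d := by
  have h := sum_moebius_div_ge σ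
  have hG : (Nat.card (N ≃ₐ[ℚ] N) : ℝ) = n := by
    rw [IsGalois.card_aut_eq_finrank, hN]
  have hm : (orderOf σ : ℝ) ≤ n := by
    have h2 : orderOf σ ≤ Module.finrank ℚ N := by
      rw [← IsGalois.card_aut_eq_finrank, Nat.card_eq_fintype_card]
      exact orderOf_le_card_univ
    rw [← hN]; exact_mod_cast h2
  have hm0 : (0 : ℝ) < orderOf σ := by exact_mod_cast orderOf_pos σ
  have hn0 : (0 : ℝ) < n := by exact_mod_cast (lt_trans Nat.zero_lt_one hn)
  rw [hG] at h
  refine le_trans ?_ h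
  rw [div_le_div_iff₀ (by positivity) (by positivity), one_mul, one_mul, sq]
  exact mul_le_mul_of_nonneg_right hm hn0.le

end Sizes

end Summit.QuantumAdvantage.QuantumAdvantage.Theorems.DegreeOnePrimesEscape

end
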